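import Summits.Ventures.AbcSig.Rows.TemplateB
import Summits.Ventures.AbcSig.Rows.TemplateC

/-!
# Venture AbcSig — ROW TEMPLATE for `xⁿ + 2^α yⁿ = C z²` (`C ≥ 3` odd squarefree): FAMILY C1b ([BS04, Thm. 1.2] shape)

HONEST FRAMING. Fully PROVED template theorems of a COMPUTATION cell (`pub-abcsig`); CONDITIONAL on named hypotheses,
no claim on ABC or any summit. They package the elementary part of the cell's FAMILY C1b rows (lead ruling FAMILY C1b,
2026-08-22T18:36Z): `A = 1`, `B = 2^α`, `C` odd squarefree. By [BS04, Lemma 2.1/3.2]: a primitive solution with `y`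
EVEN has `2⁷ ∣ 2^α yⁿ` (as `n ≥ 7`), i.e. case (v₇) at level `2·C²` (after the sign change `c ≡ C (mod 4)`); one with
`y` ODD and `α = 3` is case (iv)₃ (`ord₂ B = 3`, `xy` odd, `c ≡ C (mod 4)`) at level `2⁵·C² = 32·C²`. GIVEN, for the
exponent `n` (prime, `≥ 7`, `n ∤ C`, `α < n`): `BS04Package M` (cited), `DataComplete` (computed) and per orbit a kernel
certificate or a cited exclusion for the family predicate `famBC α C n P`, the conclusion is
`¬ IsPrimitiveSolution 1 (2^α) C n x y z` for `x·y ≠ ±1` (the census predicate `Rows.C1bCell` excludes `|xy| = 1`).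
First use: the row `census/rows/C1b/C1b-C11-a3.md` — `x¹³ + 8y¹³ = 11z²`, the explicit printed exception
`(C, α, n) = (11, 3, 13)` of [BS04, Thm. 1.2].

* `bs04OddLevel_one_twoPow` — the odd part of the Serre level for `(1, 2^α, C)` is `C²`;
* `odd_Cc_of_two_dvd_Bb` — `2 ∣ B·b` forces `C·c` odd (pairwise coprimality); `famBC` — the family predicate;
* `branchBC_v7` (`y` even, `α < n`, level `2C²`) and `branchBC_iv3` (`y` odd, `α = 3`, level `32C²`).

Reference: [BS04] M. A. Bennett, C. M. Skinner, Canad. J. Math. 56 (2004) 23–54, §§2–4 and Thm. 1.2.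
-/

namespace Summit.Ventures.AbcSig

/-- For odd squarefree `C`, `n ∤ C` and any `α`: the odd part of the Serre level for `(A, B, C) = (1, 2^α, C)` is `C²`. -/
theorem bs04OddLevel_one_twoPow (α C n : ℕ) (hsq : Squarefree C) (hodd : Odd C) (hnC : ¬ n ∣ C) :
    bs04OddLevel 1 (2 ^ α) C n = C ^ 2 := by
  have hfilt : C.primeFactors.filter (fun p => p ≠ 2 ∧ p ≠ n) = C.primeFactors := by
    apply Finset.filter_true_of_mem
    intro p hp
    have hpd : p ∣ C := Nat.dvd_of_mem_primeFactors hp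
    refine ⟨?_, ?_⟩
    · rintro rfl
      exact (Nat.not_even_iff_odd.mpr hodd) (even_iff_two_dvd.mpr hpd)
    · rintro rfl
      exact hnC hpd
  have hempty : (1 * 2 ^ α).primeFactors.filter (fun q => q ≠ 2 ∧ q ≠ n) = ∅ := by
    apply Finset.filter_false_of_mem
    intro q hq
    rw [one_mul] at hq
    have hqp : q.Prime := Nat.prime_of_mem_primeFactors hq
    have hqd : q ∣ 2 ^ α := Nat.dvd_of_mem_primeFactors hq
    have : q = 2 := (Nat.prime_dvd_prime_iff_eq hqp Nat.prime_two).mp (hqp.dvd_of_dvd_pow hqd)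
    exact fun h => h.1 this
  simp only [bs04OddLevel, hfilt, hempty, Finset.prod_empty, mul_one]
  rw [Finset.prod_pow, Nat.prod_primeFactors_of_squarefree hsq]

/-- Levels for `(1, 2^α, C)`, `C` odd squarefree, `n ∤ C`: case (v₇) gives `2·C²`, case (iv)₃ gives `32·C²`. -/
theorem bs04Level_one_twoPow (α C n : ℕ) (hsq : Squarefree C) (hodd : Odd C) (hnC : ¬ n ∣ C) :
    bs04Level .v₇ 1 (2 ^ α) C n = 2 * C ^ 2 ∧ bs04Level .iv₃ 1 (2 ^ α) C n = 32 * C ^ 2 := by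
  simp only [bs04Level, FreyCase.twoExp, bs04OddLevel_one_twoPow α C n hsq hodd hnC]
  norm_num

/-- Pairwise coprimality: if `2 ∣ B·b` then `C·c` is odd. -/
theorem odd_Cc_of_two_dvd_Bb {A B C n : ℕ} {a b c : ℤ} (h : IsPrimitiveSolution A B C n a b c)
    (h2 : 2 ∣ (B : ℤ) * b) : ¬ 2 ∣ (C : ℤ) * c := by
  intro h2c
  obtain ⟨-, -, -, -, -, -, hbc⟩ := h
  have hu := hbc.isUnit_of_dvd' h2 h2c
  rcases Int.isUnit_iff.mp hu with h | h <;> omega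

/-- Pairwise coprimality: if `2 ∣ B·b` then `A·a` is odd. -/
theorem odd_Aa_of_two_dvd_Bb {A B C n : ℕ} {a b c : ℤ} (h : IsPrimitiveSolution A B C n a b c)
    (h2 : 2 ∣ (B : ℤ) * b) : ¬ 2 ∣ (A : ℤ) * a := by
  intro h2a
  obtain ⟨-, -, -, -, hab, -, -⟩ := h
  have hu := hab.isUnit_of_dvd' h2a h2
  rcases Int.isUnit_iff.mp hu with h | h <;> omega

/-- The family predicate of the C1b templates: coefficients `(1, 2^α, C)`, exponent `n`, side condition `P a b`. -/
def famBC (α C n : ℕ) (P : ℤ → ℤ → Prop) (S : FreyDatum) : Prop :=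
  S.A = 1 ∧ S.B = 2 ^ α ∧ S.C = C ∧ S.n = n ∧ P S.a S.b

/-- `n`-th-power freeness of `A = 1`, `B = 2^α` for `α < n`. -/
theorem nthPowerFree_one_twoPow (α n : ℕ) (hα : α < n) (hn : 2 ≤ n) :
    ∀ q : ℕ, q.Prime → ¬ q ^ n ∣ 1 ∧ ¬ q ^ n ∣ 2 ^ α := by
  intro q hq
  have h1 : ¬ q ^ n ∣ 1 := by
    intro h
    have := Nat.le_of_dvd one_pos h
    have : 2 ^ n ≤ q ^ n := Nat.pow_le_pow_left hq.two_le n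
    have : 2 ^ 1 < 2 ^ n := Nat.pow_lt_pow_right (by norm_num) (by omega)
    omega
  refine ⟨h1, ?_⟩
  intro h
  have hle := Nat.le_of_dvd (by positivity) h
  have h2 : 2 ^ n ≤ q ^ n := Nat.pow_le_pow_left hq.two_le n
  have h3 : 2 ^ α < 2 ^ n := Nat.pow_lt_pow_right (by norm_num) hα
  omega

/-- **Branch (v₇), `y` even** (`α < n`, `n ≥ 7`): level `2·C²`. For odd squarefree `C`, a prime `n ≥ 7` with
`n ∤ C`, and the cell's hypotheses at level `2C²` for the family "`(1, 2^α, C)`, exponent `n`, `y` even", there is no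
primitive solution of `xⁿ + 2^α yⁿ = C z²` with `y` even and `xy ≠ ±1`. -/
theorem branchBC_v7 (α C : ℕ) (hsq : Squarefree C) (hCodd : Odd C) (M : NewformModel)
    (hP : M.BS04Package) {orbs : List OrbitData} (hD : M.DataComplete (2 * C ^ 2) orbs)
    (n : ℕ) (hn : n.Prime) (h7 : 7 ≤ n) (hnC : ¬ n ∣ C) (hαn : α < n)
    (hS : ∀ o ∈ orbs, (∀ e ∈ o.coeffs, e.ell.Prime ∧ e.ell ≠ 2 ∧ ¬ e.ell ∣ 2 * C ^ 2) ∧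
      (o.Eliminated bs04Allowed n ∨ M.Excludes (2 * C ^ 2) o (famBC α C n (fun _ b => 2 ∣ b))))
    (x y z : ℤ) (hy : 2 ∣ y) (h1 : x * y ≠ 1) (h2 : x * y ≠ -1) :
    ¬ IsPrimitiveSolution 1 (2 ^ α) C n x y z := by
  intro hsol
  have hCpos : 0 < C := hCodd.pos
  have hCoddZ : ¬ 2 ∣ (C : ℤ) := by
    intro h
    have h' : (2 : ℕ) ∣ C := by exact_mod_cast h
    exact (Nat.not_even_iff_odd.mpr hCodd) (even_iff_two_dvd.mpr h')
  have hBb : 2 ∣ ((2 ^ α : ℕ) : ℤ) * y := Dvd.dvd.mul_left hy _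
  have hCz := odd_Cc_of_two_dvd_Bb hsol hBb
  have hz : ¬ 2 ∣ z := fun h => hCz (Dvd.dvd.mul_left h _)
  obtain ⟨z', hz'sgn, hz'⟩ := exists_sign_sub_four_dvd z C hz hCoddZ
  have hsol' : IsPrimitiveSolution 1 (2 ^ α) C n x y z' := hsol.of_sign hz'sgn
  have hv : (2 : ℤ) ^ 7 ∣ ((2 ^ α : ℕ) : ℤ) * y ^ n :=
    Dvd.dvd.mul_left ((pow_dvd_pow 2 h7).trans (pow_dvd_pow_of_dvd hy n)) _
  have hcase : FreyCase.Holds .v₇ 1 (2 ^ α) C n x y z' := ⟨hv, hz'⟩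
  have hndvd : ¬ n ∣ 1 * 2 ^ α * C := by
    intro h
    rw [one_mul] at h
    rcases (Nat.Prime.dvd_mul hn).mp h with h2 | hC
    · have := (Nat.prime_dvd_prime_iff_eq hn Nat.prime_two).mp (hn.dvd_of_dvd_pow h2)
      omega
    · exact hnC hC
  exact no_solution_in_case M hP ⟨1, 2 ^ α, C, n, x, y, z'⟩ .v₇ (2 * C ^ 2) one_pos (by positivity) hCpos hsq hn h7
    hndvd (nthPowerFree_one_twoPow α n hαn (by omega)) hsol' h1 h2 hcase (bs04Level_one_twoPow α C n hsq hCodd hnC).1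
    hD (famBC α C n (fun _ b => 2 ∣ b)) ⟨rfl, rfl, rfl, rfl, hy⟩ hS

/-- **Branch (iv)₃, `y` odd, `α = 3`**: level `32·C²`. For odd squarefree `C`, a prime `n ≥ 7` with `n ∤ C`, and the
cell's hypotheses at level `32C²` for the family "`(1, 8, C)`, exponent `n`, `y` odd", there is no primitive solution of
`xⁿ + 8yⁿ = C z²` with `y` odd and `xy ≠ ±1`. -/
theorem branchBC_iv3 (C : ℕ) (hsq : Squarefree C) (hCodd : Odd C) (M : NewformModel)
    (hP : M.BS04Package) {orbs : List OrbitData} (hD : M.DataComplete (32 * C ^ 2) orbs)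
    (n : ℕ) (hn : n.Prime) (h7 : 7 ≤ n) (hnC : ¬ n ∣ C)
    (hS : ∀ o ∈ orbs, (∀ e ∈ o.coeffs, e.ell.Prime ∧ e.ell ≠ 2 ∧ ¬ e.ell ∣ 32 * C ^ 2) ∧
      (o.Eliminated bs04Allowed n ∨ M.Excludes (32 * C ^ 2) o (famBC 3 C n (fun _ b => ¬ 2 ∣ b))))
    (x y z : ℤ) (hy : ¬ 2 ∣ y) (h1 : x * y ≠ 1) (h2 : x * y ≠ -1) :
    ¬ IsPrimitiveSolution 1 (2 ^ 3) C n x y z := by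
  intro hsol
  have hCpos : 0 < C := hCodd.pos
  have hCoddZ : ¬ 2 ∣ (C : ℤ) := by
    intro h
    have h' : (2 : ℕ) ∣ C := by exact_mod_cast h
    exact (Nat.not_even_iff_odd.mpr hCodd) (even_iff_two_dvd.mpr h')
  have hBb : 2 ∣ ((2 ^ 3 : ℕ) : ℤ) * y := Dvd.dvd.mul_right (by norm_num) _
  have hCz := odd_Cc_of_two_dvd_Bb hsol hBb
  have hz : ¬ 2 ∣ z := fun h => hCz (Dvd.dvd.mul_left h _)
  have hx : ¬ 2 ∣ x := by
    have := odd_Aa_of_two_dvd_Bb hsol hBb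
    simpa using this
  have hxy : ¬ 2 ∣ x * y := by
    intro h
    rcases Int.prime_two.dvd_mul.mp h with h' | h'
    · exact hx h'
    · exact hy h'
  obtain ⟨z', hz'sgn, hz'⟩ := exists_sign_sub_four_dvd z C hz hCoddZ
  have hsol' : IsPrimitiveSolution 1 (2 ^ 3) C n x y z' := hsol.of_sign hz'sgn
  have hB3 : OrdTwoEq ((2 ^ 3 : ℕ) : ℤ) 3 := ⟨by norm_num, by norm_num⟩
  have hcase : FreyCase.Holds .iv₃ 1 (2 ^ 3) C n x y z' := ⟨hxy, hB3, hz'⟩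
  have hndvd : ¬ n ∣ 1 * 2 ^ 3 * C := by
    intro h
    rw [one_mul] at h
    rcases (Nat.Prime.dvd_mul hn).mp h with h2 | hC
    · have := (Nat.prime_dvd_prime_iff_eq hn Nat.prime_two).mp (hn.dvd_of_dvd_pow h2)
      omega
    · exact hnC hC
  exact no_solution_in_case M hP ⟨1, 2 ^ 3, C, n, x, y, z'⟩ .iv₃ (32 * C ^ 2) one_pos (by positivity) hCpos hsq hn h7
    hndvd (nthPowerFree_one_twoPow 3 n (by omega) (by omega)) hsol' h1 h2 hcase
    (bs04Level_one_twoPow 3 C n hsq hCodd hnC).2 hD (famBC 3 C n (fun _ b => ¬ 2 ∣ b)) ⟨rfl, rfl, rfl, rfl, hy⟩ hS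

end Summit.Ventures.AbcSig
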